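import Summits.ResolutionOfSingularities.ResolutionOfSingularities.Theorems.PurelyInseparableDim4FlatAbsorbComm
import HarnessLib
import HarnessLib.Audit.Tags

/-!
# Purely inseparable fourfolds — FLAT ABSORPTION: player B's moves ALONG a coordinate flat are absorbed by A's
# next centre containing the flat's directions, over EVERY field `K` of characteristic `p`

Census cell «res-dim4-pi» (D-0157 DOOR 2); seat res-rescue-typ-3 g8 (rescue base on loan per director-resolution
DR-E8 (4)); def-free support for the ∀K column of the F4-C instrument (desk WORD #65 (c)).  [OURS · counted 0 ·
statements about OUR frame-v4 game (`State`, `Edge`, `StateWins`, `InScopeStateWins`) and plain polynomial algebra,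
not about resolution.]  CONTEXT: the ∀K certificates of record (res-dim4-p-14's `UCert`/`UICert`) stop wherever the
`q`-fold locus of a chart contains a COORDINATE FLAT of positive dimension (B owns replies with transcendental free
coordinates; measured on the RUN 4b band: 679 / 1 105 roots have such a chart in EVERY permissible first centre).
FLAT ABSORPTION (file `…FlatAbsorb`): those replies are harmless as soon as A's next centre avoids the free coordinates of
the flat, because the coordinate-centre step commutes with translations off the centre.
THIS FILE: §4 **`step_step_add_F`** — for `v` vanishing on `S' ∋ j'`,
`(step p S' j' b' (step p S j (b0 + v) s)).F = (step p S' j' (b' + v) (step p S j b0 s)).F`;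
`isEquimultiplePoint_step_add_iff` («`b'` equimultiple for the translated child ↔ `b' + v` for the base child»); and
the headline **`inScopeStateWins_step_add_of_move`** (full-game twin `stateWins_step_add_of_move`): if `S'`
(`S' ∩ supp v = ∅`) is permissible at the child `step p S j b0 s` and every `S'`-edge out of that child is in-scope
escapable, then the child at `b0 + v` is in-scope escapable — for EVERY `v : Fin 4 → K` off `S'` (no hypothesis on
`v`: the flat matters only for COVERAGE of B's replies, which a certificate checker handles — sequel file).
Nothing here proves resolution of singularities in dimension ≥ 4 / characteristic `p`; F4-C(2,2) stays OPEN.  AI work,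
weaker than expert review.  bears_on: LADDER-RESOLUTION:D157-DOOR2 (res-dim4-pi · F4-C ∀K column · flat absorption).
Supports stmt-ResolutionOfSingularities-16155 (helper).
-/

set_option linter.dupNamespace false

noncomputable section
open MvPolynomial Finset
open scoped BigOperators
namespace Summit.ResolutionOfSingularities.ResolutionOfSingularities.Theorems.PIDim4

namespace FlatAbsorb

open Literature.AlgebraicGeometry.Resolution
open Literature.AlgebraicGeometry.Resolution.Hauser2010
open Literature.AlgebraicGeometry.Resolution.CentreBlowup
open InScopeWinCert

variable {K : Type} [Field K] [DecidableEq K]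

/-! ## §4 Flat absorption -/

section Absorb

variable {p : ℕ} [Fact p.Prime] [CharP K p]

/-- **The step commutes with translations off the next centre** (on `F`): for `v` vanishing on `S' ∋ j'`,
the `S'`-child at `b'` of the `S`-child at `b0 + v` has the same `F` as the `S'`-child at `b' + v` of the
`S`-child at `b0`. [folklore] -/
theorem step_step_add_F {S S' : Finset (Fin 4)} {j j' : Fin 4} (hj' : j' ∈ S') {v : Fin 4 → K}
    (hv : ∀ i ∈ S', v i = 0) (b0 b' : Fin 4 → K) (s : State K) :
    (step p S' j' b' (step p S j (b0 + v) s)).F = (step p S' j' (b' + v) (step p S j b0 s)).F := by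
  show deletePthPowers p (PointBlowup.translate b' (chartTransform p S' j'
      (deletePthPowers p (PointBlowup.translate (b0 + v) (chartTransform p S j s.F))))) =
    deletePthPowers p (PointBlowup.translate (b' + v) (chartTransform p S' j'
      (deletePthPowers p (PointBlowup.translate b0 (chartTransform p S j s.F)))))
  rw [deletePthPowers_translate_chartTransform_deletePthPowers,
    deletePthPowers_translate_chartTransform_deletePthPowers, translate_add b0 v,
    chartTransform_translate_of_forall hj' hv, add_comm b' v, translate_add v b']

omit [DecidableEq K] [Fact p.Prime] [CharP K p] in
/-- Coefficients in degrees `0 < |d| < p` ignore `p`-th power polynomials. [folklore] -/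
theorem coeff_add_eq_of_isQPow {P R : MvPolynomial (Fin 4) K} (hR : deletePthPowers p R = 0) {d : Fin 4 →₀ ℕ}
    (hd0 : d ≠ 0) (hdq : d.degree < p) : coeff d (P + R) = coeff d P := by
  rw [coeff_add, coeff_eq_zero_of_killed hR hd0 hdq, add_zero]

/-- **«Equimultiple point» transfers along the translation**: `b'` is equimultiple for the `S'`-chart of the
`S`-child at `b0 + v` iff `b' + v` is equimultiple for the `S'`-chart of the `S`-child at `b0`. [folklore] -/
theorem isEquimultiplePoint_step_add_iff {S S' : Finset (Fin 4)} {j j' : Fin 4} (hj' : j' ∈ S')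
    {v : Fin 4 → K} (hv : ∀ i ∈ S', v i = 0) (b0 b' : Fin 4 → K) (s : State K) :
    IsEquimultiplePoint p S' j' b' (step p S j (b0 + v) s) ↔
      IsEquimultiplePoint p S' j' (b' + v) (step p S j b0 s) := by
  -- both point transforms differ by a `p`-th power polynomial
  set Q := PointBlowup.translate b0 (chartTransform p S j s.F) with hQ
  have hL : pointTransform p S' j' b' (step p S j (b0 + v) s) =
      PointBlowup.translate b' (chartTransform p S' j' (deletePthPowers p (PointBlowup.translate v Q))) := by
    show PointBlowup.translate b' (chartTransform p S' j' (deletePthPowers p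
      (PointBlowup.translate (b0 + v) (chartTransform p S j s.F)))) = _
    rw [translate_add]
  have hR : pointTransform p S' j' (b' + v) (step p S j b0 s) =
      PointBlowup.translate b' (chartTransform p S' j' (PointBlowup.translate v (deletePthPowers p Q))) := by
    show PointBlowup.translate (b' + v) (chartTransform p S' j' (deletePthPowers p Q)) = _
    rw [add_comm b' v, translate_add, chartTransform_translate_of_forall hj' hv]
  -- the difference is a `p`-th power polynomial
  have hD : deletePthPowers p (deletePthPowers p (PointBlowup.translate v Q) - PointBlowup.translate v (deletePthPowers p Q)) = 0 := by
    have h1 : deletePthPowers p (deletePthPowers p (PointBlowup.translate v Q) - PointBlowup.translate v Q) = 0 := by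
      have := killed_neg (isQPow_sub_deletePthPowers p (PointBlowup.translate v Q))
      rwa [neg_sub] at this
    have h2 : deletePthPowers p (PointBlowup.translate v Q - PointBlowup.translate v (deletePthPowers p Q)) = 0 := by
      unfold PointBlowup.translate; rw [← map_sub]; exact killed_translate (isQPow_sub_deletePthPowers p Q) v
    have h12 := killed_add h1 h2
    rwa [sub_add_sub_cancel] at h12
  have hdiff : deletePthPowers p (pointTransform p S' j' b' (step p S j (b0 + v) s) -
      pointTransform p S' j' (b' + v) (step p S j b0 s)) = 0 := by
    rw [hL, hR]
    unfold PointBlowup.translate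
    rw [← map_sub, ← chartTransform_sub]
    exact killed_translate (killed_chartTransform S' j' hD) b'
  constructor
  · intro h d hd0 hdq
    have := h d hd0 hdq
    have key := coeff_add_eq_of_isQPow (P := pointTransform p S' j' (b' + v) (step p S j b0 s)) hdiff hd0 hdq
    rw [add_sub_cancel] at key
    rw [← key]; exact this
  · intro h d hd0 hdq
    have := h d hd0 hdq
    have key := coeff_add_eq_of_isQPow (P := pointTransform p S' j' b' (step p S j (b0 + v) s)) (killed_neg hdiff) hd0 hdq
    rw [neg_sub, add_sub_cancel] at key
    rw [← key]; exact this

/-- **FLAT ABSORPTION (in-scope game).**  Let `s` be a state, `S` a centre, `j` a chart, `b0` a point, and `S'`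
a centre avoiding the support of `v`.  If `S'` is permissible at the child `step p S j b0 s` and every `S'`-edge out
of it leads to an in-scope escapable state, then the child at `b0 + v` is in-scope escapable.  (B's translation `v`
along the directions off `S'` is absorbed by A's move `S'`: the `S'`-edges out of the translated child are, on `F`,
exactly `S'`-edges out of the base child at shifted points.) [folklore] -/
theorem inScopeStateWins_step_add_of_move {S S' : Finset (Fin 4)} {j : Fin 4} {v : Fin 4 → K}
    (hv : ∀ i ∈ S', v i = 0) {b0 : Fin 4 → K} {s : State K}
    (hperm : IsPermissibleCentre p S' (step p S j b0 s).F)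
    (hkids : ∀ t, Edge p S' (step p S j b0 s) t → InScopeStateWins p t) :
    InScopeStateWins p (step p S j (b0 + v) s) := by
  refine inScopeStateWins_move S' ?_ fun t ht => ?_
  · -- permissibility at the translated child
    have hF : (step p S j (b0 + v) s).F =
        deletePthPowers p (PointBlowup.translate v (deletePthPowers p
          (PointBlowup.translate b0 (chartTransform p S j s.F)))) := by
      show deletePthPowers p (PointBlowup.translate (b0 + v) (chartTransform p S j s.F)) = _
      rw [deletePthPowers_translate_deletePthPowers, translate_add]
    rw [hF]
    exact isPermissibleCentre_deletePthPowers_translate hv hperm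
  · obtain ⟨j', b', hj', hbj', heq, hne, rfl⟩ := ht
    have hF := step_step_add_F (S := S) (j := j) hj' hv b0 b' s
    have heq' := (isEquimultiplePoint_step_add_iff (S := S) (j := j) hj' hv b0 b' s).mp heq
    have hne' : (step p S' j' (b' + v) (step p S j b0 s)).F ≠ 0 := by rwa [← hF]
    have hedge : Edge p S' (step p S j b0 s) (step p S' j' (b' + v) (step p S j b0 s)) :=
      ⟨j', b' + v, hj', by rw [Pi.add_apply, hbj', hv j' hj', add_zero], heq', hne', rfl⟩
    exact inScopeStateWins_congr (hkids _ hedge) _ hF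

/-- **FLAT ABSORPTION (full game).** [folklore] -/
theorem stateWins_step_add_of_move {S S' : Finset (Fin 4)} {j : Fin 4} {v : Fin 4 → K}
    (hv : ∀ i ∈ S', v i = 0) {b0 : Fin 4 → K} {s : State K}
    (hperm : IsPermissibleCentre p S' (step p S j b0 s).F)
    (hkids : ∀ t, Edge p S' (step p S j b0 s) t → StateWins p t) :
    StateWins p (step p S j (b0 + v) s) := by
  refine Game.Wins.move (m := S') ?_ fun t ht => ?_
  · have hF : (step p S j (b0 + v) s).F =
        deletePthPowers p (PointBlowup.translate v (deletePthPowers p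
          (PointBlowup.translate b0 (chartTransform p S j s.F)))) := by
      show deletePthPowers p (PointBlowup.translate (b0 + v) (chartTransform p S j s.F)) = _
      rw [deletePthPowers_translate_deletePthPowers, translate_add]
    show IsPermissibleCentre p S' (step p S j (b0 + v) s).F
    rw [hF]
    exact isPermissibleCentre_deletePthPowers_translate hv hperm
  · obtain ⟨j', b', hj', hbj', heq, hne, rfl⟩ := ht
    have hF := step_step_add_F (S := S) (j := j) hj' hv b0 b' s
    have heq' := (isEquimultiplePoint_step_add_iff (S := S) (j := j) hj' hv b0 b' s).mp heq
    have hne' : (step p S' j' (b' + v) (step p S j b0 s)).F ≠ 0 := by rwa [← hF]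
    have hedge : Edge p S' (step p S j b0 s) (step p S' j' (b' + v) (step p S j b0 s)) :=
      ⟨j', b' + v, hj', by rw [Pi.add_apply, hbj', hv j' hj', add_zero], heq', hne', rfl⟩
    exact stateWins_congr (hkids _ hedge) _ hF

end Absorb

end FlatAbsorb

end Summit.ResolutionOfSingularities.ResolutionOfSingularities.Theorems.PIDim4

end
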